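import Summits.QuantumFields.YangMills.Theorems.VirialFluxGapRingFrameDefs
import HarnessLib

/-!
# Route `VirialFluxGap` (YangMills): the zero-flux ring deficit is DIFFERENTIABLE ALONG THE LEFT-INVARIANT FRAME — the `DF` package of
# the Euler-field hypothesis for the standard one-variable translation curves

Toward the deciding crux `VirialFluxGap.PeriodicSoftness` (item stmt-QuantumFields-24141).  The virial ∕ IBP reduction
✓`EulerFieldReduction.periodicSoftness_of_eulerField` consumes, for every translation curve `γ` of the coefficient field, the derivative
of the deficit along the curve: `HasDerivAt (s ↦ F₀(x·γ(s))) (DF t x) t` with `DF` bounded and `DF 0` strongly measurable.  This file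
supplies that package ONCE AND FOR ALL for the standard frame curves — one `SU(2)` variable `v` of the ring history turned to the right
along a one-parameter subgroup, `γ_{v,Y}(s) = mulSingle_v(e^{sY})`, `Y ∈ 𝔰𝔲(2)` (✓`SUNBakryEmery.expSU`):

* (part 1, ✓`VirialFluxGapRingFrameDefs`: `F₀ = ringPoly ∘ ringCoord`, `contDiff_ringPoly`, the curves `sliceCurve ∕ seamCurve`, the tangent
  families, `sliceFrameDeriv ∕ seamFrameDeriv`);
* §0 the ring space is compact and its open sets are measurable; §2′ `hasDerivAt_ringCoord_sliceCurve ∕ _seamCurve` — the coordinates along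
  a frame curve are differentiable with derivative the tangent family at the moving point;
* §3 ★★ `hasDerivAt_ringDeficit_sliceCurve` ∕ `_seamCurve` — `HasDerivAt (s ↦ F₀(P·γ(s))) (frameDeriv (P·γ(t))) t` with
  `frameDeriv P = D(ringPoly)(ringCoord P)[tangent P]` (chain rule + the subgroup law), ★ `continuous_frameDeriv`, ★ `frameDeriv_bounded`
  (compactness of the ring space), ★ `stronglyMeasurable_frameDeriv` — i.e. exactly the clauses `hDF`, `hDFb`, `hDFm` of the Euler-field
  hypothesis, for every slice variable `(i,e)`, every seam site `x` and every direction `Y`.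

* §4 evaluation rule `hasDerivAt_ringPoly_line_*` (frameDeriv = `d/ds ringPoly(M + s·tangent)|₀`), linearity in `Y`; §5 the SAME chain
  rule ∕ smoothness ∕ regularity for ARBITRARY smooth functions of the coordinates (`hasDerivAt_comp_ringCoord_*`,
  `contDiff_fderiv_*Tangent`, `regular_comp_ringCoord`) — so Hessians, resolvent coefficients and their divergences iterate inside the
  smooth-functions-of-the-coordinates world.

HONEST FRAMING: calculus bookkeeping (Mathlib + the landed one-matrix calculus of ✓`SUNBakryEmeryPoincare`); the coefficient functions `φ_j` and
the two pointwise inequalities of the Euler field are NOT here; ⟨24141⟩ stays OPEN; the Yang–Mills mass gap is NOT proved; no summit is proved by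
a line.  THEOREMS ONLY (0 `def`, 0 `sorry`), standard axioms.  Width seat `ym-line-sfw-p2-w3` g58 (cell
ym-idea-1, free hands), `--supports stmt-QuantumFields-24141`.
References: [cite: arXiv220412737, §2 (2.4) (p. 10)] (left-invariant derivatives on matrix groups); [cite: Luscher1983, §2].
-/

set_option autoImplicit false

noncomputable section

open scoped Matrix BigOperators ContDiff Topology
open MeasureTheory
open Literature.MathematicalPhysics.QuantumFieldTheory hiding SU2
open Literature.MathematicalPhysics.QuantumLattice
open Literature.MathematicalPhysics.QuantumFieldTheory.SUNBakryEmery (expSU coe_expSU matTop)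

namespace Summit.QuantumFields.YangMills.Theorems.VirialFluxGap.FrameDerivative

open Summit.QuantumFields.YangMills.Theorems.FemtoTransferGap
open Summit.QuantumFields.YangMills.Theorems.FemtoTransferGap.TT
open Summit.QuantumFields.YangMills.Theorems.VirialFluxGap.RingDeficit
open Summit.QuantumFields.YangMills.Theorems.VirialFluxGap.ChartPhase

variable {L : ℕ} [NeZero L]

/-! ## §0 Topological ∕ measurable structure of the ring space (stated before the Frobenius topology is installed) -/

omit [NeZero L] in
/-- The ring space is compact (finite product of copies of `SU(2)`). [folklore] -/
theorem compactSpace_ringSpace : CompactSpace ((Fin (2 * L - 1 + 1) → GaugeConfig 3 L SU2) × (Site 3 L → SU2)) := by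
  infer_instance

/-- Open sets of the ring space are measurable (second countability of `SU(2)`, finiteness of the index sets). [folklore] -/
theorem opensMeasurableSpace_ringSpace :
    OpensMeasurableSpace ((Fin (2 * L - 1 + 1) → GaugeConfig 3 L SU2) × (Site 3 L → SU2)) := by
  haveI : SecondCountableTopology SU2 := secondCountableTopology_su2
  infer_instance

open scoped Matrix.Norms.Frobenius

attribute [local instance 2000] Literature.MathematicalPhysics.QuantumFieldTheory.SUNBakryEmery.matTop

/-! ## §2′ The coordinates along a frame curve are differentiable -/

omit [NeZero L] in
/-- `exp(sA)` commutes with `A` (any square matrix). [folklore] -/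
theorem exp_smul_comm (A : Matrix (Fin 2) (Fin 2) ℂ) (s : ℝ) : A * NormedSpace.exp (s • A) = NormedSpace.exp (s • A) * A :=
  ((Commute.refl A).smul_right s).exp_right.eq

/-- ★ The coordinates along the slice curve are differentiable, with derivative the tangent family at the moving point. [folklore] -/
theorem hasDerivAt_ringCoord_sliceCurve (i : Fin (2 * L - 1 + 1)) (e : Edge 3 L) {Y : Matrix (Fin 2) (Fin 2) ℂ} (hY : Yᴴ = -Y)
    (hY0 : Y.trace = 0) (P : (Fin (2 * L - 1 + 1) → GaugeConfig 3 L SU2) × (Site 3 L → SU2)) (t : ℝ) :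
    HasDerivAt (fun s => ringCoord L (P * sliceCurve i e hY hY0 s)) (sliceTangent i e Y (P * sliceCurve i e hY hY0 t)) t := by
  have heq : (fun s => ringCoord L (P * sliceCurve i e hY hY0 s)) = fun s =>
      ((fun i' e' => (P.1 i' e' : Matrix (Fin 2) (Fin 2) ℂ) * NormedSpace.exp (s • sliceDir i e Y i' e'),
        fun x => (P.2 x : Matrix (Fin 2) (Fin 2) ℂ)) :
        (Fin (2 * L - 1 + 1) → Edge 3 L → Matrix (Fin 2) (Fin 2) ℂ) × (Site 3 L → Matrix (Fin 2) (Fin 2) ℂ)) :=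
    funext fun s => ringCoord_mul_sliceCurve i e hY hY0 P s
  rw [heq]
  have htan : sliceTangent i e Y (P * sliceCurve i e hY hY0 t) =
      ((fun i' e' => (P.1 i' e' : Matrix (Fin 2) (Fin 2) ℂ) * (sliceDir i e Y i' e' * NormedSpace.exp (t • sliceDir i e Y i' e')),
        fun _ => (0 : Matrix (Fin 2) (Fin 2) ℂ)) :
        (Fin (2 * L - 1 + 1) → Edge 3 L → Matrix (Fin 2) (Fin 2) ℂ) × (Site 3 L → Matrix (Fin 2) (Fin 2) ℂ)) := by
    unfold sliceTangent
    refine Prod.ext ?_ rfl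
    funext i' e'
    have hc := congrArg Prod.fst (ringCoord_mul_sliceCurve i e hY hY0 P t)
    simp only [ringCoord] at hc
    have hc' := congrFun (congrFun hc i') e'
    dsimp only at hc' ⊢
    rw [hc', Matrix.mul_assoc, ← exp_smul_comm]
  rw [htan]
  refine HasDerivAt.prodMk ?_ (hasDerivAt_const _ _)
  refine hasDerivAt_pi.2 fun i' => hasDerivAt_pi.2 fun e' => ?_
  exact (hasDerivAt_exp_smul_const' (𝕂 := ℝ) (sliceDir i e Y i' e') t).const_mul _

/-- ★ The coordinates along the seam curve are differentiable, with derivative the tangent family at the moving point. [folklore] -/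
theorem hasDerivAt_ringCoord_seamCurve (x : Site 3 L) {Y : Matrix (Fin 2) (Fin 2) ℂ} (hY : Yᴴ = -Y) (hY0 : Y.trace = 0)
    (P : (Fin (2 * L - 1 + 1) → GaugeConfig 3 L SU2) × (Site 3 L → SU2)) (t : ℝ) :
    HasDerivAt (fun s => ringCoord L (P * seamCurve x hY hY0 s)) (seamTangent x Y (P * seamCurve x hY hY0 t)) t := by
  have heq : (fun s => ringCoord L (P * seamCurve x hY hY0 s)) = fun s =>
      ((fun i' e' => (P.1 i' e' : Matrix (Fin 2) (Fin 2) ℂ),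
        fun x' => (P.2 x' : Matrix (Fin 2) (Fin 2) ℂ) * NormedSpace.exp (s • seamDir x Y x')) :
        (Fin (2 * L - 1 + 1) → Edge 3 L → Matrix (Fin 2) (Fin 2) ℂ) × (Site 3 L → Matrix (Fin 2) (Fin 2) ℂ)) :=
    funext fun s => ringCoord_mul_seamCurve x hY hY0 P s
  rw [heq]
  have htan : seamTangent x Y (P * seamCurve x hY hY0 t) =
      ((fun _ _ => (0 : Matrix (Fin 2) (Fin 2) ℂ),
        fun x' => (P.2 x' : Matrix (Fin 2) (Fin 2) ℂ) * (seamDir x Y x' * NormedSpace.exp (t • seamDir x Y x'))) :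
        (Fin (2 * L - 1 + 1) → Edge 3 L → Matrix (Fin 2) (Fin 2) ℂ) × (Site 3 L → Matrix (Fin 2) (Fin 2) ℂ)) := by
    unfold seamTangent
    refine Prod.ext rfl ?_
    funext x'
    have hc := congrArg Prod.snd (ringCoord_mul_seamCurve x hY hY0 P t)
    simp only [ringCoord] at hc
    have hc' := congrFun hc x'
    dsimp only at hc' ⊢
    rw [hc', Matrix.mul_assoc, ← exp_smul_comm]
  rw [htan]
  refine HasDerivAt.prodMk ?_ ?_
  · exact hasDerivAt_pi.2 fun i' => hasDerivAt_pi.2 fun e' => hasDerivAt_const _ _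
  · exact hasDerivAt_pi.2 fun x' => (hasDerivAt_exp_smul_const' (𝕂 := ℝ) (seamDir x Y x') t).const_mul _

/-! ## §3 The frame derivative of the deficit: existence, continuity, boundedness, measurability -/

/-- ★★ **The deficit is differentiable along every slice frame curve**, at every parameter, with derivative the frame derivative at
the moving point: `HasDerivAt (s ↦ F₀(P·γ(s))) (sliceFrameDeriv (P·γ(t))) t`. [cite: arXiv220412737, §2 (2.4) (p. 10)] -/
theorem hasDerivAt_ringDeficit_sliceCurve (i : Fin (2 * L - 1 + 1)) (e : Edge 3 L) {Y : Matrix (Fin 2) (Fin 2) ℂ} (hY : Yᴴ = -Y)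
    (hY0 : Y.trace = 0) (P : (Fin (2 * L - 1 + 1) → GaugeConfig 3 L SU2) × (Site 3 L → SU2)) (t : ℝ) :
    HasDerivAt (fun s => ringDeficit L (fun _ => false) (P * sliceCurve i e hY hY0 s))
      (sliceFrameDeriv i e Y (P * sliceCurve i e hY hY0 t)) t := by
  have heq : (fun s => ringDeficit L (fun _ => false) (P * sliceCurve i e hY hY0 s)) =
      fun s => ringPoly L (ringCoord L (P * sliceCurve i e hY hY0 s)) := funext fun s => ringDeficit_eq_ringPoly _
  rw [heq, sliceFrameDeriv]
  have hd : DifferentiableAt ℝ (ringPoly L) (ringCoord L (P * sliceCurve i e hY hY0 t)) :=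
    (contDiff_ringPoly (L := L)).differentiable (by simp) _
  exact hd.hasFDerivAt.comp_hasDerivAt t (hasDerivAt_ringCoord_sliceCurve i e hY hY0 P t)

/-- ★★ **The deficit is differentiable along every seam frame curve.** [cite: arXiv220412737, §2 (2.4) (p. 10)] -/
theorem hasDerivAt_ringDeficit_seamCurve (x : Site 3 L) {Y : Matrix (Fin 2) (Fin 2) ℂ} (hY : Yᴴ = -Y) (hY0 : Y.trace = 0)
    (P : (Fin (2 * L - 1 + 1) → GaugeConfig 3 L SU2) × (Site 3 L → SU2)) (t : ℝ) :
    HasDerivAt (fun s => ringDeficit L (fun _ => false) (P * seamCurve x hY hY0 s))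
      (seamFrameDeriv x Y (P * seamCurve x hY hY0 t)) t := by
  have heq : (fun s => ringDeficit L (fun _ => false) (P * seamCurve x hY hY0 s)) =
      fun s => ringPoly L (ringCoord L (P * seamCurve x hY hY0 s)) := funext fun s => ringDeficit_eq_ringPoly _
  rw [heq, seamFrameDeriv]
  have hd : DifferentiableAt ℝ (ringPoly L) (ringCoord L (P * seamCurve x hY hY0 t)) :=
    (contDiff_ringPoly (L := L)).differentiable (by simp) _
  exact hd.hasFDerivAt.comp_hasDerivAt t (hasDerivAt_ringCoord_seamCurve x hY hY0 P t)

omit [NeZero L] in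
/-- The slice tangent family is continuous in the ring history. [folklore] -/
theorem continuous_sliceTangent (i : Fin (2 * L - 1 + 1)) (e : Edge 3 L) (Y : Matrix (Fin 2) (Fin 2) ℂ) :
    Continuous (sliceTangent (L := L) i e Y) := by
  refine Continuous.prodMk ?_ continuous_const
  refine continuous_pi fun i' => continuous_pi fun e' => ?_
  exact (continuous_subtype_val.comp ((continuous_apply e').comp ((continuous_apply i').comp continuous_fst))).mul continuous_const

omit [NeZero L] in
/-- The seam tangent family is continuous in the ring history. [folklore] -/
theorem continuous_seamTangent (x : Site 3 L) (Y : Matrix (Fin 2) (Fin 2) ℂ) : Continuous (seamTangent (L := L) x Y) := by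
  refine Continuous.prodMk continuous_const ?_
  refine continuous_pi fun x' => ?_
  exact (continuous_subtype_val.comp ((continuous_apply x').comp continuous_snd)).mul continuous_const

/-- ★ **The slice frame derivative is continuous** on the ring space. [folklore] -/
theorem continuous_sliceFrameDeriv (i : Fin (2 * L - 1 + 1)) (e : Edge 3 L) (Y : Matrix (Fin 2) (Fin 2) ℂ) :
    Continuous (sliceFrameDeriv (L := L) i e Y) := by
  unfold sliceFrameDeriv
  have h1 : Continuous (fderiv ℝ (ringPoly L)) := (contDiff_ringPoly (L := L)).continuous_fderiv (by simp)
  exact (h1.comp continuous_ringCoord).clm_apply (continuous_sliceTangent i e Y)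

/-- ★ **The seam frame derivative is continuous** on the ring space. [folklore] -/
theorem continuous_seamFrameDeriv (x : Site 3 L) (Y : Matrix (Fin 2) (Fin 2) ℂ) : Continuous (seamFrameDeriv (L := L) x Y) := by
  unfold seamFrameDeriv
  have h1 : Continuous (fderiv ℝ (ringPoly L)) := (contDiff_ringPoly (L := L)).continuous_fderiv (by simp)
  exact (h1.comp continuous_ringCoord).clm_apply (continuous_seamTangent x Y)

/-- ★ **The slice frame derivative is bounded** (continuity on the compact ring space). [folklore] -/
theorem sliceFrameDeriv_bounded (i : Fin (2 * L - 1 + 1)) (e : Edge 3 L) (Y : Matrix (Fin 2) (Fin 2) ℂ) :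
    ∃ B : ℝ, ∀ P, |sliceFrameDeriv (L := L) i e Y P| ≤ B := by
  haveI : CompactSpace ((Fin (2 * L - 1 + 1) → GaugeConfig 3 L SU2) × (Site 3 L → SU2)) := compactSpace_ringSpace (L := L)
  obtain ⟨B, hB⟩ := isCompact_univ.exists_bound_of_continuousOn (continuous_sliceFrameDeriv (L := L) i e Y).continuousOn
  exact ⟨B, fun P => by simpa [Real.norm_eq_abs] using hB P (Set.mem_univ P)⟩

/-- ★ **The seam frame derivative is bounded.** [folklore] -/
theorem seamFrameDeriv_bounded (x : Site 3 L) (Y : Matrix (Fin 2) (Fin 2) ℂ) :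
    ∃ B : ℝ, ∀ P, |seamFrameDeriv (L := L) x Y P| ≤ B := by
  haveI : CompactSpace ((Fin (2 * L - 1 + 1) → GaugeConfig 3 L SU2) × (Site 3 L → SU2)) := compactSpace_ringSpace (L := L)
  obtain ⟨B, hB⟩ := isCompact_univ.exists_bound_of_continuousOn (continuous_seamFrameDeriv (L := L) x Y).continuousOn
  exact ⟨B, fun P => by simpa [Real.norm_eq_abs] using hB P (Set.mem_univ P)⟩

/-- ★ **The slice frame derivative is strongly measurable.** [folklore] -/
theorem stronglyMeasurable_sliceFrameDeriv (i : Fin (2 * L - 1 + 1)) (e : Edge 3 L) (Y : Matrix (Fin 2) (Fin 2) ℂ) :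
    StronglyMeasurable (sliceFrameDeriv (L := L) i e Y) := by
  haveI : OpensMeasurableSpace ((Fin (2 * L - 1 + 1) → GaugeConfig 3 L SU2) × (Site 3 L → SU2)) :=
    opensMeasurableSpace_ringSpace (L := L)
  exact (continuous_sliceFrameDeriv i e Y).stronglyMeasurable

/-- ★ **The seam frame derivative is strongly measurable.** [folklore] -/
theorem stronglyMeasurable_seamFrameDeriv (x : Site 3 L) (Y : Matrix (Fin 2) (Fin 2) ℂ) :
    StronglyMeasurable (seamFrameDeriv (L := L) x Y) := by
  haveI : OpensMeasurableSpace ((Fin (2 * L - 1 + 1) → GaugeConfig 3 L SU2) × (Site 3 L → SU2)) :=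
    opensMeasurableSpace_ringSpace (L := L)
  exact (continuous_seamFrameDeriv x Y).stronglyMeasurable

/-- ★★★ **The `DF` package of the Euler-field hypothesis for a slice frame curve**: with `γ = sliceCurve i e Y` and
`DF t P := sliceFrameDeriv i e Y (P·γ(t))` — `γ 0 = 1`, `HasDerivAt (s ↦ F₀(P·γ s)) (DF t P) t` for all `t`, a uniform bound
`|DF t P| ≤ B`, and `DF 0` strongly measurable. [cite: arXiv220412737, §2 (2.4) (p. 10)] -/
theorem slice_DF_package (i : Fin (2 * L - 1 + 1)) (e : Edge 3 L) {Y : Matrix (Fin 2) (Fin 2) ℂ} (hY : Yᴴ = -Y) (hY0 : Y.trace = 0) :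
    sliceCurve (L := L) i e hY hY0 0 = 1 ∧
    (∀ (P : (Fin (2 * L - 1 + 1) → GaugeConfig 3 L SU2) × (Site 3 L → SU2)) (t : ℝ),
      HasDerivAt (fun s => ringDeficit L (fun _ => false) (P * sliceCurve i e hY hY0 s))
        (sliceFrameDeriv i e Y (P * sliceCurve i e hY hY0 t)) t) ∧
    (∃ B : ℝ, ∀ (P : (Fin (2 * L - 1 + 1) → GaugeConfig 3 L SU2) × (Site 3 L → SU2)) (t : ℝ),
      |sliceFrameDeriv i e Y (P * sliceCurve i e hY hY0 t)| ≤ B) ∧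
    StronglyMeasurable (fun P : (Fin (2 * L - 1 + 1) → GaugeConfig 3 L SU2) × (Site 3 L → SU2) =>
      sliceFrameDeriv i e Y (P * sliceCurve i e hY hY0 0)) := by
  refine ⟨sliceCurve_zero i e hY hY0, fun P t => hasDerivAt_ringDeficit_sliceCurve i e hY hY0 P t, ?_, ?_⟩
  · obtain ⟨B, hB⟩ := sliceFrameDeriv_bounded (L := L) i e Y
    exact ⟨B, fun P t => hB _⟩
  · simp only [sliceCurve_zero, mul_one]
    exact stronglyMeasurable_sliceFrameDeriv i e Y

/-- ★★★ **The `DF` package of the Euler-field hypothesis for a seam frame curve.** [cite: arXiv220412737, §2 (2.4) (p. 10)] -/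
theorem seam_DF_package (x : Site 3 L) {Y : Matrix (Fin 2) (Fin 2) ℂ} (hY : Yᴴ = -Y) (hY0 : Y.trace = 0) :
    seamCurve (L := L) x hY hY0 0 = 1 ∧
    (∀ (P : (Fin (2 * L - 1 + 1) → GaugeConfig 3 L SU2) × (Site 3 L → SU2)) (t : ℝ),
      HasDerivAt (fun s => ringDeficit L (fun _ => false) (P * seamCurve x hY hY0 s))
        (seamFrameDeriv x Y (P * seamCurve x hY hY0 t)) t) ∧
    (∃ B : ℝ, ∀ (P : (Fin (2 * L - 1 + 1) → GaugeConfig 3 L SU2) × (Site 3 L → SU2)) (t : ℝ),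
      |seamFrameDeriv x Y (P * seamCurve x hY hY0 t)| ≤ B) ∧
    StronglyMeasurable (fun P : (Fin (2 * L - 1 + 1) → GaugeConfig 3 L SU2) × (Site 3 L → SU2) =>
      seamFrameDeriv x Y (P * seamCurve x hY hY0 0)) := by
  refine ⟨seamCurve_zero x hY hY0, fun P t => hasDerivAt_ringDeficit_seamCurve x hY hY0 P t, ?_, ?_⟩
  · obtain ⟨B, hB⟩ := seamFrameDeriv_bounded (L := L) x Y
    exact ⟨B, fun P t => hB _⟩
  · simp only [seamCurve_zero, mul_one]
    exact stronglyMeasurable_seamFrameDeriv x Y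

/-! ## §4 The frame derivative as a line derivative of the polynomial (for explicit evaluation) -/

/-- ★ **Evaluation rule**: the slice frame derivative is the derivative at `s = 0` of the explicit one-variable polynomial
`s ↦ ringPoly(ringCoord P + s · sliceTangent P)` (degree `≤ 4` in `s`) — this is how a constructor of the Euler field computes `X·F₀`
from the insertion formula, term by term. [folklore] -/
theorem hasDerivAt_ringPoly_line_slice (i : Fin (2 * L - 1 + 1)) (e : Edge 3 L) (Y : Matrix (Fin 2) (Fin 2) ℂ)
    (P : (Fin (2 * L - 1 + 1) → GaugeConfig 3 L SU2) × (Site 3 L → SU2)) :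
    HasDerivAt (fun s : ℝ => ringPoly L (ringCoord L P + s • sliceTangent i e Y P)) (sliceFrameDeriv i e Y P) 0 := by
  have hline : HasDerivAt (fun s : ℝ => ringCoord L P + s • sliceTangent i e Y P) (sliceTangent i e Y P) 0 := by
    have h := ((hasDerivAt_id (0 : ℝ)).smul_const (sliceTangent i e Y P)).const_add (ringCoord L P)
    simpa using h
  have hd : DifferentiableAt ℝ (ringPoly L) (ringCoord L P + (0 : ℝ) • sliceTangent i e Y P) :=
    (contDiff_ringPoly (L := L)).differentiable (by simp) _
  have h := hd.hasFDerivAt.comp_hasDerivAt (0 : ℝ) hline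
  rw [zero_smul, add_zero] at h
  exact h

/-- ★ **Evaluation rule** for the seam frame derivative. [folklore] -/
theorem hasDerivAt_ringPoly_line_seam (x : Site 3 L) (Y : Matrix (Fin 2) (Fin 2) ℂ)
    (P : (Fin (2 * L - 1 + 1) → GaugeConfig 3 L SU2) × (Site 3 L → SU2)) :
    HasDerivAt (fun s : ℝ => ringPoly L (ringCoord L P + s • seamTangent x Y P)) (seamFrameDeriv x Y P) 0 := by
  have hline : HasDerivAt (fun s : ℝ => ringCoord L P + s • seamTangent x Y P) (seamTangent x Y P) 0 := by
    have h := ((hasDerivAt_id (0 : ℝ)).smul_const (seamTangent x Y P)).const_add (ringCoord L P)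
    simpa using h
  have hd : DifferentiableAt ℝ (ringPoly L) (ringCoord L P + (0 : ℝ) • seamTangent x Y P) :=
    (contDiff_ringPoly (L := L)).differentiable (by simp) _
  have h := hd.hasFDerivAt.comp_hasDerivAt (0 : ℝ) hline
  rw [zero_smul, add_zero] at h
  exact h

/-- The frame derivatives are additive and homogeneous in the direction `Y` (linearity of the tangent family and of `D(ringPoly)`).
[folklore] -/
theorem sliceFrameDeriv_add_smul (i : Fin (2 * L - 1 + 1)) (e : Edge 3 L) (Y Y' : Matrix (Fin 2) (Fin 2) ℂ) (a : ℝ)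
    (P : (Fin (2 * L - 1 + 1) → GaugeConfig 3 L SU2) × (Site 3 L → SU2)) :
    sliceFrameDeriv i e (Y + a • Y') P = sliceFrameDeriv i e Y P + a * sliceFrameDeriv i e Y' P := by
  have htan : sliceTangent i e (Y + a • Y') P = sliceTangent i e Y P + a • sliceTangent i e Y' P := by
    unfold sliceTangent sliceDir
    refine Prod.ext ?_ ?_
    · funext i' e'
      simp only [Prod.fst_add, Prod.smul_fst, Pi.add_apply, Pi.smul_apply]
      by_cases h : i' = i ∧ e' = e
      · rw [if_pos h, if_pos h, if_pos h, Matrix.mul_add, Matrix.mul_smul]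
      · rw [if_neg h, if_neg h, if_neg h, Matrix.mul_zero, smul_zero, add_zero]
    · funext x
      simp only [Prod.snd_add, Prod.smul_snd, Pi.add_apply, Pi.smul_apply, smul_zero, add_zero]
  rw [sliceFrameDeriv, sliceFrameDeriv, sliceFrameDeriv, htan, map_add, map_smul, smul_eq_mul]

/-! ## §5 Frame calculus for ARBITRARY smooth functions of the coordinates (for second derivatives ∕ Hessians ∕ coefficient fields) -/

/-- The slice tangent family is the coordinate family times the direction family (so it factors through `ringCoord`). [folklore] -/
theorem sliceTangent_eq (i : Fin (2 * L - 1 + 1)) (e : Edge 3 L) (Y : Matrix (Fin 2) (Fin 2) ℂ)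
    (P : (Fin (2 * L - 1 + 1) → GaugeConfig 3 L SU2) × (Site 3 L → SU2)) :
    sliceTangent i e Y P = ((fun i' e' => (ringCoord L P).1 i' e' * sliceDir i e Y i' e', fun _ => 0) :
      (Fin (2 * L - 1 + 1) → Edge 3 L → Matrix (Fin 2) (Fin 2) ℂ) × (Site 3 L → Matrix (Fin 2) (Fin 2) ℂ)) := rfl

/-- The seam tangent family factors through `ringCoord`. [folklore] -/
theorem seamTangent_eq (x : Site 3 L) (Y : Matrix (Fin 2) (Fin 2) ℂ)
    (P : (Fin (2 * L - 1 + 1) → GaugeConfig 3 L SU2) × (Site 3 L → SU2)) :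
    seamTangent x Y P = ((fun _ _ => 0, fun x' => (ringCoord L P).2 x' * seamDir x Y x') :
      (Fin (2 * L - 1 + 1) → Edge 3 L → Matrix (Fin 2) (Fin 2) ℂ) × (Site 3 L → Matrix (Fin 2) (Fin 2) ℂ)) := rfl

/-- ★★ **Chain rule along a slice frame curve for ANY smooth function of the coordinates**: for `f : W → ℝ` of class `C^∞`,
`HasDerivAt (s ↦ f(ringCoord(P·γ(s)))) (Df(ringCoord(P·γ t))[sliceTangent(P·γ t)]) t`.  With `f = ringPoly` this is
`hasDerivAt_ringDeficit_sliceCurve`; with `f = M ↦ D ringPoly(M)[T_j M]` it gives SECOND frame derivatives (Hessians), and so on —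
every iterate stays a smooth function of the coordinates (`contDiff_fderiv_sliceTangent`). [cite: arXiv220412737, §2 (2.4) (p. 10)] -/
theorem hasDerivAt_comp_ringCoord_sliceCurve
    {f : (Fin (2 * L - 1 + 1) → Edge 3 L → Matrix (Fin 2) (Fin 2) ℂ) × (Site 3 L → Matrix (Fin 2) (Fin 2) ℂ) → ℝ} (hf : ContDiff ℝ ∞ f)
    (i : Fin (2 * L - 1 + 1)) (e : Edge 3 L) {Y : Matrix (Fin 2) (Fin 2) ℂ} (hY : Yᴴ = -Y) (hY0 : Y.trace = 0)
    (P : (Fin (2 * L - 1 + 1) → GaugeConfig 3 L SU2) × (Site 3 L → SU2)) (t : ℝ) :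
    HasDerivAt (fun s => f (ringCoord L (P * sliceCurve i e hY hY0 s)))
      (fderiv ℝ f (ringCoord L (P * sliceCurve i e hY hY0 t)) (sliceTangent i e Y (P * sliceCurve i e hY hY0 t))) t :=
  ((hf.differentiable (by simp) _).hasFDerivAt).comp_hasDerivAt t (hasDerivAt_ringCoord_sliceCurve i e hY hY0 P t)

/-- ★★ **Chain rule along a seam frame curve for any smooth function of the coordinates.** [cite: arXiv220412737, §2 (2.4) (p. 10)] -/
theorem hasDerivAt_comp_ringCoord_seamCurve
    {f : (Fin (2 * L - 1 + 1) → Edge 3 L → Matrix (Fin 2) (Fin 2) ℂ) × (Site 3 L → Matrix (Fin 2) (Fin 2) ℂ) → ℝ} (hf : ContDiff ℝ ∞ f)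
    (x : Site 3 L) {Y : Matrix (Fin 2) (Fin 2) ℂ} (hY : Yᴴ = -Y) (hY0 : Y.trace = 0)
    (P : (Fin (2 * L - 1 + 1) → GaugeConfig 3 L SU2) × (Site 3 L → SU2)) (t : ℝ) :
    HasDerivAt (fun s => f (ringCoord L (P * seamCurve x hY hY0 s)))
      (fderiv ℝ f (ringCoord L (P * seamCurve x hY hY0 t)) (seamTangent x Y (P * seamCurve x hY hY0 t))) t :=
  ((hf.differentiable (by simp) _).hasFDerivAt).comp_hasDerivAt t (hasDerivAt_ringCoord_seamCurve x hY hY0 P t)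

/-- ★ **Frame derivatives of smooth functions are smooth** (slice direction): `M ↦ Df(M)[(M·Y_w)_w, 0]` is `C^∞` when `f` is — so the
frame calculus iterates (Hessians, divergence of coefficient fields built from derivatives of `F₀`). [folklore] -/
theorem contDiff_fderiv_sliceTangent
    {f : (Fin (2 * L - 1 + 1) → Edge 3 L → Matrix (Fin 2) (Fin 2) ℂ) × (Site 3 L → Matrix (Fin 2) (Fin 2) ℂ) → ℝ} (hf : ContDiff ℝ ∞ f)
    (i : Fin (2 * L - 1 + 1)) (e : Edge 3 L) (Y : Matrix (Fin 2) (Fin 2) ℂ) :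
    ContDiff ℝ ∞ fun M : (Fin (2 * L - 1 + 1) → Edge 3 L → Matrix (Fin 2) (Fin 2) ℂ) × (Site 3 L → Matrix (Fin 2) (Fin 2) ℂ) =>
      fderiv ℝ f M ((fun i' e' => M.1 i' e' * sliceDir i e Y i' e', fun _ => 0) :
        (Fin (2 * L - 1 + 1) → Edge 3 L → Matrix (Fin 2) (Fin 2) ℂ) × (Site 3 L → Matrix (Fin 2) (Fin 2) ℂ)) := by
  have h1 : ContDiff ℝ ∞ (fderiv ℝ f) := hf.fderiv_right (m := ∞) le_rfl
  have h2 : ContDiff ℝ ∞ fun M : (Fin (2 * L - 1 + 1) → Edge 3 L → Matrix (Fin 2) (Fin 2) ℂ) × (Site 3 L → Matrix (Fin 2) (Fin 2) ℂ) =>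
      ((fun i' e' => M.1 i' e' * sliceDir i e Y i' e', fun _ => 0) :
        (Fin (2 * L - 1 + 1) → Edge 3 L → Matrix (Fin 2) (Fin 2) ℂ) × (Site 3 L → Matrix (Fin 2) (Fin 2) ℂ)) := by
    refine ContDiff.prodMk ?_ contDiff_const
    refine contDiff_pi.2 fun i' => contDiff_pi.2 fun e' => ?_
    exact (contDiff_coord_fst i' e').mul contDiff_const
  exact h1.clm_apply h2

/-- ★ **Frame derivatives of smooth functions are smooth** (seam direction). [folklore] -/
theorem contDiff_fderiv_seamTangent
    {f : (Fin (2 * L - 1 + 1) → Edge 3 L → Matrix (Fin 2) (Fin 2) ℂ) × (Site 3 L → Matrix (Fin 2) (Fin 2) ℂ) → ℝ} (hf : ContDiff ℝ ∞ f)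
    (x : Site 3 L) (Y : Matrix (Fin 2) (Fin 2) ℂ) :
    ContDiff ℝ ∞ fun M : (Fin (2 * L - 1 + 1) → Edge 3 L → Matrix (Fin 2) (Fin 2) ℂ) × (Site 3 L → Matrix (Fin 2) (Fin 2) ℂ) =>
      fderiv ℝ f M ((fun _ _ => 0, fun x' => M.2 x' * seamDir x Y x') :
        (Fin (2 * L - 1 + 1) → Edge 3 L → Matrix (Fin 2) (Fin 2) ℂ) × (Site 3 L → Matrix (Fin 2) (Fin 2) ℂ)) := by
  have h1 : ContDiff ℝ ∞ (fderiv ℝ f) := hf.fderiv_right (m := ∞) le_rfl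
  have h2 : ContDiff ℝ ∞ fun M : (Fin (2 * L - 1 + 1) → Edge 3 L → Matrix (Fin 2) (Fin 2) ℂ) × (Site 3 L → Matrix (Fin 2) (Fin 2) ℂ) =>
      ((fun _ _ => 0, fun x' => M.2 x' * seamDir x Y x') :
        (Fin (2 * L - 1 + 1) → Edge 3 L → Matrix (Fin 2) (Fin 2) ℂ) × (Site 3 L → Matrix (Fin 2) (Fin 2) ℂ)) := by
    refine ContDiff.prodMk contDiff_const ?_
    refine contDiff_pi.2 fun x' => ?_
    exact (contDiff_coord_snd x').mul contDiff_const
  exact h1.clm_apply h2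

/-- ★ **Smooth functions of the coordinates are continuous, bounded and strongly measurable on the ring space** — the regularity clauses
of the Euler-field hypothesis for ANY coefficient ∕ derivative built by the frame calculus. [folklore] -/
theorem regular_comp_ringCoord
    {f : (Fin (2 * L - 1 + 1) → Edge 3 L → Matrix (Fin 2) (Fin 2) ℂ) × (Site 3 L → Matrix (Fin 2) (Fin 2) ℂ) → ℝ} (hf : Continuous f) :
    Continuous (fun P : (Fin (2 * L - 1 + 1) → GaugeConfig 3 L SU2) × (Site 3 L → SU2) => f (ringCoord L P)) ∧
    (∃ B : ℝ, ∀ P : (Fin (2 * L - 1 + 1) → GaugeConfig 3 L SU2) × (Site 3 L → SU2), |f (ringCoord L P)| ≤ B) ∧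
    StronglyMeasurable (fun P : (Fin (2 * L - 1 + 1) → GaugeConfig 3 L SU2) × (Site 3 L → SU2) => f (ringCoord L P)) := by
  have hc : Continuous (fun P : (Fin (2 * L - 1 + 1) → GaugeConfig 3 L SU2) × (Site 3 L → SU2) => f (ringCoord L P)) :=
    hf.comp continuous_ringCoord
  haveI : CompactSpace ((Fin (2 * L - 1 + 1) → GaugeConfig 3 L SU2) × (Site 3 L → SU2)) := compactSpace_ringSpace (L := L)
  haveI : OpensMeasurableSpace ((Fin (2 * L - 1 + 1) → GaugeConfig 3 L SU2) × (Site 3 L → SU2)) :=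
    opensMeasurableSpace_ringSpace (L := L)
  obtain ⟨B, hB⟩ := isCompact_univ.exists_bound_of_continuousOn hc.continuousOn
  exact ⟨hc, ⟨B, fun P => by simpa [Real.norm_eq_abs] using hB P (Set.mem_univ P)⟩, hc.stronglyMeasurable⟩

/-- The coordinates of a ring history are measurable in the history (for measurability of coefficient fields). [folklore] -/
theorem measurable_comp_ringCoord
    {f : (Fin (2 * L - 1 + 1) → Edge 3 L → Matrix (Fin 2) (Fin 2) ℂ) × (Site 3 L → Matrix (Fin 2) (Fin 2) ℂ) → ℝ} (hf : Continuous f) :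
    Measurable (fun P : (Fin (2 * L - 1 + 1) → GaugeConfig 3 L SU2) × (Site 3 L → SU2) => f (ringCoord L P)) :=
  (regular_comp_ringCoord (L := L) hf).2.2.measurable

end Summit.QuantumFields.YangMills.Theorems.VirialFluxGap.FrameDerivative

end
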